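import Summits.Ventures.YMGap.Thresholds.PressureSecondDerivative
import Summits.Ventures.YMGap.Thresholds.PressureDerivativeSUN
import Summits.Ventures.YMGap.RobustBall.PlaquettePositivity
import HarnessLib

/-!
# The mean plaquette is NON-DECREASING in the coupling on the strong-coupling window — `SU(2)` on `ℤ⁴` and every
# `SU(N)` on `ℤ^d` — from convexity of the free energy density (row type C-PRESS, part 6; no correlation inequality)

Cell `pub-ymgap`, seat ds-1 (gen 9). HONEST FRAMING: strong-coupling LATTICE statements for `SU(N)` Wilson lattice gauge theory
on `ℤ^d`: monotonicity (non-strict) of the mean plaquette `u = ⟨(1/N) Re tr U_p⟩` in the coupling on the one-state window, and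
non-negativity of the plaquette–plaquette static susceptibility there; nothing about larger couplings, the continuum or the
Clay problem. No Griffiths/GKS-type inequality is used (none is available for non-abelian gauge groups); the mechanism is:
uniqueness ⇒ the DLR state is a torus limit point ⇒ translation and axis-permutation invariant
(`RobustBall.PlaquettePositivity.integral_plaquetteObs_eq`) ⇒ all plaquettes have ONE expectation `u`; part 1/3 ⇒
`f'(β) = -(#planes) · N · (1 - u(β))` at every coupling of the open window; `f` is convex (`convexOn_freeEnergyDensity`) and
differentiable there, so `f'` is non-decreasing (`ConvexOn.monotoneOn_deriv`), hence so is `u`; the closed window follows by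
continuity (C-LIP-STAR) via `monotoneOn_of_deriv_nonneg`; the susceptibility `Σ_q Cov(W_p, W_q)` is the derivative of `u`
(C-DIFF), hence `≥ 0`. Kernel theorems only, 0 compute.

* `mem_infiniteVolumeLimitPoints_of_subsingleton`, `integral_plaquetteObs_eq_of_subsingleton` (any compact `G`, `d ≥ 2`);
* `SU(2)`, `d = 4`, tree window `[0, 9/50]` (Wilson `β_W = 2β ∈ [0, 9/25]`): `su2_integral_plaquetteObs_eq` (plane independence),
  ★ `su2_deriv_freeEnergyDensity_eq_plaquette` (`f'(β) = -12(1 - u(β))`, i.e. `g'(β_W) = -6(1 - u)`),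
  `su2_monotoneOn_deriv_freeEnergyDensity`, ★★ `su2_plaquette_monotoneOn` / `su2_meanPlaquette_monotoneOn` (u non-decreasing on
  the closed window along ANY DLR selection, every plaquette), ★ `su2_plaquette_responseSum_nonneg` (`0 ≤ Σ_q Cov_ν(W_p, W_q)` for
  every DLR state at every `0 < β < 9/50`);
* every `SU(N)`, `N ≥ 2`, every `d ≥ 2`, window `[0, N/(12(d-1))]`: `integral_zdPlaquetteObs_eq_dim_thooft`,
  ★ `deriv_freeEnergyDensity_eq_plaquette_dim_thooft` (`f' = -(d(d-1)/2) N (1 - u)`), ★★ `plaquette_monotoneOn_dim_thooft`,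
  ★ `plaquette_responseSum_nonneg_dim_thooft`.
-/

noncomputable section

open MeasureTheory ProbabilityTheory Set Filter Topology
open scoped NNReal
open Literature.MathematicalPhysics.QuantumLattice (LGConfig ZdEdge ZdPlaquette fundamentalRep ymGibbsMeasures
  ymSpecification plaquetteObs plaquetteEdges freeEnergyDensity IsZdTranslationInvariant
  infiniteVolumeLimitPoints_nonempty_holds continuous_fundamentalRep)
open Literature.MathematicalPhysics.QuantumFieldTheory hiding ZdEdge

namespace Summit.Ventures.YMGap.PressureRegularity

/-! ## E. Plane independence, `f' = -12(1 - u)`, and MONOTONICITY OF THE MEAN PLAQUETTE on the window -/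

section LimitPoint

open Literature.MathematicalPhysics.QuantumLattice (infiniteVolumeLimitPoints
  mem_ymGibbsMeasures_of_mem_infiniteVolumeLimitPoints_holds)

variable {d N : ℕ} {G : Type*} [Group G] [TopologicalSpace G] [IsTopologicalGroup G] [CompactSpace G]
  [MeasurableSpace G] [BorelSpace G] [SecondCountableTopology G] [T2Space G]

/-- **In a uniqueness regime every DLR state is an infinite-volume limit point of the torus states** (limit points exist,
`infiniteVolumeLimitPoints_nonempty_holds`, and are DLR, `mem_ymGibbsMeasures_of_mem_infiniteVolumeLimitPoints_holds`). [folklore] -/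
theorem mem_infiniteVolumeLimitPoints_of_subsingleton (ρ : G →* Matrix (Fin N) (Fin N) ℂ) (hρ : Continuous ρ) {β : ℝ}
    (hsub : (ymGibbsMeasures (d := d) ρ β).Subsingleton) {μ : Measure (LGConfig d G)}
    (hμ : μ ∈ ymGibbsMeasures (d := d) ρ β) : μ ∈ infiniteVolumeLimitPoints (d := d) ρ β := by
  obtain ⟨ν, hν⟩ := infiniteVolumeLimitPoints_nonempty_holds (d := d) ρ hρ β
  rw [hsub hμ (mem_ymGibbsMeasures_of_mem_infiniteVolumeLimitPoints_holds ρ hρ hν)]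
  exact hν

/-- **In a uniqueness regime all plaquettes have the same expectation** (translation and axis-permutation invariance of
the limit points, rb-p2's `PlaquettePositivity.integral_plaquetteObs_eq`). [folklore] -/
theorem integral_plaquetteObs_eq_of_subsingleton [NeZero d] (ρ : G →* Matrix (Fin N) (Fin N) ℂ) (hρ : Continuous ρ)
    (hd : 2 ≤ d) {β : ℝ} (hsub : (ymGibbsMeasures (d := d) ρ β).Subsingleton) {μ : Measure (LGConfig d G)}
    (hμ : μ ∈ ymGibbsMeasures (d := d) ρ β) (y : Literature.Probability.LatticeModels.Site d) {i j : Fin d} (hij : i ≠ j) :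
    ∫ U, plaquetteObs ρ y i j U ∂μ = ∫ U, plaquetteObs ρ 0 0 1 U ∂μ :=
  RobustBall.PlaquettePositivity.integral_plaquetteObs_eq ρ hρ hd
    (mem_infiniteVolumeLimitPoints_of_subsingleton ρ hρ hsub hμ) y hij

end LimitPoint

section SU2Monotone

open Summit.Ventures.YMGap.CouplingResponse (su2_continuousOn_integral)

/-- Local shorthand: the planes `{(i, j) : i < j}` of `ℤ⁴`. -/
local notation3 (prettyPrint := false) "𝔓₄" => {q : Fin 4 × Fin 4 // q.1 < q.2}

/-- `SU(2)` is second countable (closed subgroup of `2 × 2` complex matrices). [folklore] -/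
private theorem secondCountable_su2'' : SecondCountableTopology (Matrix.specialUnitaryGroup (Fin 2) ℂ) :=
  haveI : SecondCountableTopology (Matrix (Fin 2) (Fin 2) ℂ) :=
    inferInstanceAs (SecondCountableTopology (Fin 2 → Fin 2 → ℂ))
  Topology.IsEmbedding.subtypeVal.secondCountableTopology

/-- **`SU(2)`, `d = 4`, window `[0, 9/50]`: every plaquette has the expectation of the origin plaquette in the `(0,1)` plane.** -/
theorem su2_integral_plaquetteObs_eq {β : ℝ} (hβ : β ∈ Icc (0 : ℝ) (9 / 50))
    {ν : Measure (LGConfig 4 (Matrix.specialUnitaryGroup (Fin 2) ℂ))}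
    (hν : ν ∈ ymGibbsMeasures (d := 4) (fundamentalRep (Fin 2)) β) (p : ZdPlaquette 4) :
    ∫ U, plaquetteObs (fundamentalRep (Fin 2)) p.1 p.2.1.1 p.2.1.2 U ∂ν =
      ∫ U, plaquetteObs (fundamentalRep (Fin 2)) 0 0 1 U ∂ν :=
  haveI := secondCountable_su2''
  integral_plaquetteObs_eq_of_subsingleton _ (continuous_fundamentalRep _) (by norm_num)
    (su2_subsingleton_ymGibbsMeasures hβ) hν p.1 (ne_of_lt p.2.2)

/-- ★ **`f'(β) = -12 (1 - u(β))`** for `SU(2)`, `d = 4`, at every `0 < β < 9/50` (tree coupling), `u = ⟨½ Re tr U_p⟩_ν` the mean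
plaquette of any (the) DLR state `ν ∈ 𝒢(β)` — the six planes contribute equally. Wilson form: `g'(β_W) = -6 (1 - u(β_W))`. -/
theorem su2_deriv_freeEnergyDensity_eq_plaquette {β : ℝ} (hβ : β ∈ Ioo (0 : ℝ) (9 / 50))
    {ν : Measure (LGConfig 4 (Matrix.specialUnitaryGroup (Fin 2) ℂ))}
    (hν : ν ∈ ymGibbsMeasures (d := 4) (fundamentalRep (Fin 2)) β) :
    deriv (freeEnergyDensity 4 (fundamentalRep (Fin 2))) β =
      -12 * (1 - ∫ U, zdPlaquetteObs (fundamentalRep (Fin 2)) 0 0 1 U ∂ν) := by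
  rw [su2_deriv_freeEnergyDensity_eq hβ hν]
  have h01 : ∫ U, plaquetteObs (fundamentalRep (Fin 2)) 0 0 1 U ∂ν =
      2 * ∫ U, zdPlaquetteObs (fundamentalRep (Fin 2)) 0 0 1 U ∂ν := by
    simpa using integral_plaquetteObs_eq_mul (((0 : Literature.Probability.LatticeModels.Site 4),
      ⟨((0 : Fin 4), (1 : Fin 4)), by decide⟩) : ZdPlaquette 4) ν
  have hplane : ∀ q : 𝔓₄, ∫ U, plaquetteObs (fundamentalRep (Fin 2)) 0 q.1.1 q.1.2 U ∂ν =
      2 * ∫ U, zdPlaquetteObs (fundamentalRep (Fin 2)) 0 0 1 U ∂ν := fun q => by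
    rw [su2_integral_plaquetteObs_eq (Ioo_subset_Icc_self hβ) hν ((0 : Literature.Probability.LatticeModels.Site 4), q), h01]
  rw [Finset.sum_congr rfl fun q _ => by rw [hplane q], Finset.sum_const, Finset.card_univ, nsmul_eq_mul]
  have hcard : (Fintype.card 𝔓₄ : ℝ) = 6 := by
    rw [Fintype.card_subtype]; norm_cast
  rw [hcard]
  ring

/-- **The derivative of the free energy density is non-decreasing on the open window** (convexity of `f`,
`convexOn_freeEnergyDensity`, and differentiability at every point of `(0, 9/50)`, part 1). -/
theorem su2_monotoneOn_deriv_freeEnergyDensity :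
    MonotoneOn (deriv (freeEnergyDensity 4 (fundamentalRep (Fin 2)))) (Ioo (0 : ℝ) (9 / 50)) := by
  haveI := secondCountable_su2''
  have hconv := convexOn_freeEnergyDensity (d := 4) (fundamentalRep (Fin 2)) (continuous_fundamentalRep _)
  exact (hconv.subset (subset_univ _) (convex_Ioo _ _)).monotoneOn_deriv fun x hx =>
    (su2_differentiableOn_freeEnergyDensity x hx).differentiableAt (Ioo_mem_nhds hx.1 hx.2)

/-- ★★ **MONOTONICITY OF THE MEAN PLAQUETTE ON THE STRONG-COUPLING WINDOW** (`SU(2)`, `d = 4`): along ANY DLR selection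
`μ` on `[0, 9/50]` (tree coupling; Wilson `β_W = 2β ∈ [0, 9/25]`) and for EVERY plaquette `p`, `β ↦ ⟨Re tr U_p⟩_{μ β}` is
NON-DECREASING on `[0, 9/50]`. No correlation inequality is used (none is available for non-abelian groups): `⟨Re tr U_p⟩ = 2 + f'/6`
on the open window (`su2_deriv_freeEnergyDensity_eq_plaquette`), `f'` is non-decreasing by convexity, and the endpoints follow by
continuity (C-LIP-STAR) through `monotoneOn_of_deriv_nonneg`. -/
theorem su2_plaquette_monotoneOn
    {μ : ℝ → Measure (LGConfig 4 (Matrix.specialUnitaryGroup (Fin 2) ℂ))}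
    (hμ : ∀ β ∈ Icc (0 : ℝ) (9 / 50), μ β ∈ ymGibbsMeasures (d := 4) (fundamentalRep (Fin 2)) β) (p : ZdPlaquette 4) :
    MonotoneOn (fun β => ∫ U, plaquetteObs (fundamentalRep (Fin 2)) p.1 p.2.1.1 p.2.1.2 U ∂(μ β)) (Icc (0 : ℝ) (9 / 50)) := by
  -- the affine image of `f'`
  set g : ℝ → ℝ := fun s => 2 + deriv (freeEnergyDensity 4 (fundamentalRep (Fin 2))) s / 6 with hg
  have hgmono : MonotoneOn g (Ioo (0 : ℝ) (9 / 50)) := fun x hx y hy hxy => by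
    have := su2_monotoneOn_deriv_freeEnergyDensity hx hy hxy
    simp only [hg]
    linarith
  -- on the open window the plaquette expectation IS `g`
  have heq : ∀ s ∈ Ioo (0 : ℝ) (9 / 50),
      ∫ U, plaquetteObs (fundamentalRep (Fin 2)) p.1 p.2.1.1 p.2.1.2 U ∂(μ s) = g s := fun s hs => by
    have h1 := su2_deriv_freeEnergyDensity_eq_plaquette hs (hμ s (Ioo_subset_Icc_self hs))
    have h2 := su2_integral_plaquetteObs_eq (Ioo_subset_Icc_self hs) (hμ s (Ioo_subset_Icc_self hs)) p
    have h3 := integral_plaquetteObs_eq_mul (((0 : Literature.Probability.LatticeModels.Site 4),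
        ⟨((0 : Fin 4), (1 : Fin 4)), by decide⟩) : ZdPlaquette 4) (μ s)
    simp only [hg]
    rw [h2, h1]
    simp only at h3
    rw [h3]
    push_cast
    ring
  refine monotoneOn_of_deriv_nonneg (convex_Icc _ _) (su2_continuousOn_plaquette hμ p) ?_ ?_
  · rw [interior_Icc]
    exact fun s hs => (su2_hasDerivAt_plaquette_tree hμ p hs).differentiableAt.differentiableWithinAt
  · rw [interior_Icc]
    intro s hs
    have hev : (fun t => ∫ U, plaquetteObs (fundamentalRep (Fin 2)) p.1 p.2.1.1 p.2.1.2 U ∂(μ t)) =ᶠ[𝓝 s] g :=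
      Filter.eventuallyEq_of_mem (Ioo_mem_nhds hs.1 hs.2) fun t ht => heq t ht
    rw [hev.deriv_eq, ← derivWithin_of_isOpen isOpen_Ioo hs]
    exact hgmono.derivWithin_nonneg

/-- ★★ **Wilson normalisation**: along any DLR selection `β_W ↦ μ β_W ∈ 𝒢(2(β_W/4))` on `[0, 9/25]`, the mean plaquette
`u(β_W) = ⟨½ Re tr U_p⟩_{μ β_W}` is non-decreasing on `[0, 9/25]`, for every plaquette `p`. -/
theorem su2_meanPlaquette_monotoneOn
    {μ : ℝ → Measure (LGConfig 4 (Matrix.specialUnitaryGroup (Fin 2) ℂ))}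
    (hμ : ∀ βW ∈ Icc (0 : ℝ) (9 / 25), μ βW ∈ ymGibbsMeasures (d := 4) (fundamentalRep (Fin 2)) (2 * (βW / 4)))
    (p : ZdPlaquette 4) :
    MonotoneOn (fun βW => ∫ U, zdPlaquetteObs (fundamentalRep (Fin 2)) p.1 p.2.1.1 p.2.1.2 U ∂(μ βW))
      (Icc (0 : ℝ) (9 / 25)) := by
  -- the tree-coupling selection `β ↦ μ (2β)`
  have hν : ∀ β ∈ Icc (0 : ℝ) (9 / 50), μ (2 * β) ∈ ymGibbsMeasures (d := 4) (fundamentalRep (Fin 2)) β := by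
    intro β hβ
    have h := hμ (2 * β) ⟨by linarith [hβ.1], by linarith [hβ.2]⟩
    rwa [show (2 : ℝ) * (2 * β / 4) = β by ring] at h
  have hm := su2_plaquette_monotoneOn hν p
  intro a ha b hb hab
  have h := hm (a := a / 2) ⟨by linarith [ha.1], by linarith [ha.2]⟩ (b := b / 2) ⟨by linarith [hb.1], by linarith [hb.2]⟩
    (by linarith)
  simp only at h
  rw [show (2 : ℝ) * (a / 2) = a by ring, show (2 : ℝ) * (b / 2) = b by ring,
    integral_plaquetteObs_eq_mul p (μ a), integral_plaquetteObs_eq_mul p (μ b)] at h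
  simpa using h

/-- ★ **The plaquette–plaquette static susceptibility is non-negative**: `0 ≤ Σ_q Cov_ν(W_p, W_q)` for every DLR state at every
`0 < β < 9/50` and every plaquette `p` (it is the derivative of the non-decreasing mean plaquette, C-DIFF). -/
theorem su2_plaquette_responseSum_nonneg {β : ℝ} (hβ : β ∈ Ioo (0 : ℝ) (9 / 50))
    {ν : Measure (LGConfig 4 (Matrix.specialUnitaryGroup (Fin 2) ℂ))}
    (hν : ν ∈ ymGibbsMeasures (d := 4) (fundamentalRep (Fin 2)) β) (p : ZdPlaquette 4) :
    0 ≤ ∑' q : ZdPlaquette 4, cov[zdPlaquetteObs (fundamentalRep (Fin 2)) p.1 p.2.1.1 p.2.1.2,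
      zdPlaquetteObs (fundamentalRep (Fin 2)) q.1 q.2.1.1 q.2.1.2; ν] := by
  classical
  obtain ⟨μ, hμ⟩ := CouplingResponse.exists_dlrSelection
  set μ' : ℝ → Measure (LGConfig 4 (Matrix.specialUnitaryGroup (Fin 2) ℂ)) :=
    fun t => if t = β then ν else μ (2 * t) with hμ'
  have hsel : ∀ t ∈ Icc (0 : ℝ) (9 / 50), μ' t ∈ ymGibbsMeasures (d := 4) (fundamentalRep (Fin 2)) t := by
    intro t _
    by_cases ht : t = β
    · simp only [hμ', ht, if_true]; exact hν
    · simp only [hμ', ht, if_false]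
      have h := hμ (2 * t)
      rwa [show (2 : ℝ) * (2 * t / 4) = t by ring] at h
  have hmono := su2_plaquette_monotoneOn hsel p
  have hd := su2_hasDerivAt_plaquette_tree hsel p hβ
  have hμ'β : μ' β = ν := by simp [hμ']
  rw [hμ'β] at hd
  have h1 : 0 ≤ derivWithin (fun t => ∫ U, plaquetteObs (fundamentalRep (Fin 2)) p.1 p.2.1.1 p.2.1.2 U ∂(μ' t))
      (Icc (0 : ℝ) (9 / 50)) β := hmono.derivWithin_nonneg
  rw [derivWithin_of_mem_nhds (Icc_mem_nhds hβ.1 hβ.2), hd.deriv] at h1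
  linarith

end SU2Monotone

section SUNMonotone

/-- Local shorthand: the planes `{(i, j) : i < j}`. -/
local notation3 (prettyPrint := false) "𝔓" d => {q : Fin d × Fin d // q.1 < q.2}

variable {d N : ℕ}

/-- `SU(N)` is second countable (closed subgroup of `N × N` complex matrices). [folklore] -/
private theorem secondCountable_suN_mono : SecondCountableTopology (Matrix.specialUnitaryGroup (Fin N) ℂ) :=
  haveI : SecondCountableTopology (Matrix (Fin N) (Fin N) ℂ) :=
    inferInstanceAs (SecondCountableTopology (Fin N → Fin N → ℂ))
  Topology.IsEmbedding.subtypeVal.secondCountableTopology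

/-- **Every `SU(N)`, `N ≥ 2`, every `d ≥ 2`, window `[0, N/(12(d-1))]`: all plaquettes have the same expectation in THE state**
(the expectation of `p` equals that of the reference plaquette `p₀ = (0; 0, 1)`). -/
theorem integral_zdPlaquetteObs_eq_dim_thooft (hd : 2 ≤ d) (hN : 2 ≤ N) {b : ℝ}
    (hb : b ∈ Icc (0 : ℝ) ((N : ℝ) / (12 * ((d : ℝ) - 1))))
    {ν : Measure (LGConfig d (Matrix.specialUnitaryGroup (Fin N) ℂ))}
    (hν : ν ∈ ymGibbsMeasures (d := d) (fundamentalRep (Fin N)) b) (p : ZdPlaquette d) :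
    ∫ U, zdPlaquetteObs (fundamentalRep (Fin N)) p.1 p.2.1.1 p.2.1.2 U ∂ν =
      ∫ U, zdPlaquetteObs (fundamentalRep (Fin N)) 0 ⟨0, by omega⟩ ⟨1, by omega⟩ U ∂ν := by
  haveI := secondCountable_suN_mono (N := N)
  haveI : NeZero d := ⟨by omega⟩
  have hN0 : (0 : ℝ) < N := by exact_mod_cast (show 0 < N by omega)
  have hsub := subsingleton_ymGibbsMeasures_dim_thooft hd hN hb
  set p₀ : ZdPlaquette d := ((0 : Literature.Probability.LatticeModels.Site d),
    ⟨((⟨0, by omega⟩ : Fin d), (⟨1, by omega⟩ : Fin d)), by simp [Fin.lt_def]⟩) with hp₀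
  have hp := integral_plaquetteObs_eq_of_subsingleton _ (continuous_fundamentalRep _) hd hsub hν p.1 (ne_of_lt p.2.2)
  have hq := integral_plaquetteObs_eq_of_subsingleton _ (continuous_fundamentalRep _) hd hsub hν p₀.1 (ne_of_lt p₀.2.2)
  have hpq : ∫ U, plaquetteObs (fundamentalRep (Fin N)) p.1 p.2.1.1 p.2.1.2 U ∂ν =
      ∫ U, plaquetteObs (fundamentalRep (Fin N)) p₀.1 p₀.2.1.1 p₀.2.1.2 U ∂ν := hp.trans hq.symm
  rw [integral_plaquetteObs_eq_mul p ν, integral_plaquetteObs_eq_mul p₀ ν] at hpq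
  have h := (mul_right_inj' hN0.ne').1 hpq
  simpa [hp₀] using h

/-- ★ **Every `SU(N)`, `N ≥ 2`, every `d ≥ 2`: `f'(b) = -(d(d-1)/2) · N · (1 - u(b))`** at every `0 < b < N/(12(d-1))`, `u = ⟨W_{p₀}⟩_ν`,
`W = (1/N) Re tr` — all planes contribute equally. -/
theorem deriv_freeEnergyDensity_eq_plaquette_dim_thooft (hd : 2 ≤ d) (hN : 2 ≤ N) {b : ℝ}
    (hb : b ∈ Ioo (0 : ℝ) ((N : ℝ) / (12 * ((d : ℝ) - 1))))
    {ν : Measure (LGConfig d (Matrix.specialUnitaryGroup (Fin N) ℂ))}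
    (hν : ν ∈ ymGibbsMeasures (d := d) (fundamentalRep (Fin N)) b) :
    deriv (freeEnergyDensity d (fundamentalRep (Fin N))) b =
      -(Fintype.card (𝔓 d) : ℝ) * (N : ℝ) *
        (1 - ∫ U, zdPlaquetteObs (fundamentalRep (Fin N)) 0 ⟨0, by omega⟩ ⟨1, by omega⟩ U ∂ν) := by
  rw [deriv_freeEnergyDensity_eq_dim_thooft hd hN hb hν]
  set I₀ : ℝ := ∫ U, zdPlaquetteObs (fundamentalRep (Fin N)) 0 ⟨0, by omega⟩ ⟨1, by omega⟩ U ∂ν with hI₀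
  have hplane : ∀ q : 𝔓 d, ∫ U, plaquetteObs (fundamentalRep (Fin N)) 0 q.1.1 q.1.2 U ∂ν = (N : ℝ) * I₀ := fun q => by
    have h := integral_plaquetteObs_eq_mul (((0 : Literature.Probability.LatticeModels.Site d), q) : ZdPlaquette d) ν
    simp only at h
    rw [h, hI₀, ← integral_zdPlaquetteObs_eq_dim_thooft hd hN (Ioo_subset_Icc_self hb) hν ((0 : _), q)]
  have hsum : ∑ q : 𝔓 d, ((N : ℝ) - ∫ U, plaquetteObs (fundamentalRep (Fin N)) 0 q.1.1 q.1.2 U ∂ν) =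
      (Fintype.card (𝔓 d) : ℝ) * ((N : ℝ) - (N : ℝ) * I₀) := by
    rw [Finset.sum_congr rfl fun q _ => show _ = (N : ℝ) - (N : ℝ) * I₀ by rw [hplane q], Finset.sum_const,
      Finset.card_univ, nsmul_eq_mul]
  rw [hsum]
  ring

/-- ★★ **Every `SU(N)`, `N ≥ 2`, every `d ≥ 2`: the mean plaquette is NON-DECREASING on the window `[0, N/(12(d-1))]`**
(tree coupling), along any DLR selection, for every plaquette — convexity of `f`, `f' = -D N (1 - u)`, continuity. -/
theorem plaquette_monotoneOn_dim_thooft (hd : 2 ≤ d) (hN : 2 ≤ N)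
    {μ : ℝ → Measure (LGConfig d (Matrix.specialUnitaryGroup (Fin N) ℂ))}
    (hμ : ∀ b ∈ Icc (0 : ℝ) ((N : ℝ) / (12 * ((d : ℝ) - 1))), μ b ∈ ymGibbsMeasures (d := d) (fundamentalRep (Fin N)) b)
    (p : ZdPlaquette d) :
    MonotoneOn (fun b => ∫ U, zdPlaquetteObs (fundamentalRep (Fin N)) p.1 p.2.1.1 p.2.1.2 U ∂(μ b))
      (Icc (0 : ℝ) ((N : ℝ) / (12 * ((d : ℝ) - 1)))) := by
  haveI := secondCountable_suN_mono (N := N)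
  have hN0 : (0 : ℝ) < N := by exact_mod_cast (show 0 < N by omega)
  have hC0 : (0 : ℝ) < (Fintype.card (𝔓 d) : ℝ) := by
    have : 0 < Fintype.card (𝔓 d) := Fintype.card_pos_iff.2
      ⟨⟨((⟨0, by omega⟩ : Fin d), (⟨1, by omega⟩ : Fin d)), by simp [Fin.lt_def]⟩⟩
    exact_mod_cast this
  set b₁ : ℝ := (N : ℝ) / (12 * ((d : ℝ) - 1)) with hb₁
  set f := freeEnergyDensity d (fundamentalRep (Fin N)) with hf
  -- convexity: `f'` non-decreasing on the open window
  have hconv := convexOn_freeEnergyDensity (d := d) (fundamentalRep (Fin N)) (continuous_fundamentalRep _)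
  have hmonof : MonotoneOn (deriv f) (Ioo (0 : ℝ) b₁) :=
    (hconv.subset (subset_univ _) (convex_Ioo _ _)).monotoneOn_deriv fun x hx =>
      (hasDerivAt_freeEnergyDensity_dim_thooft hd hN hμ hx).differentiableAt
  set g : ℝ → ℝ := fun s => 1 + deriv f s / ((Fintype.card (𝔓 d) : ℝ) * N) with hg
  have hgmono : MonotoneOn g (Ioo (0 : ℝ) b₁) := fun x hx y hy hxy => by
    have := hmonof hx hy hxy
    simp only [hg]
    have := div_le_div_of_nonneg_right this (mul_pos hC0 hN0).le
    linarith
  -- on the open window the expectation of `p` is `g`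
  have heq : ∀ s ∈ Ioo (0 : ℝ) b₁, ∫ U, zdPlaquetteObs (fundamentalRep (Fin N)) p.1 p.2.1.1 p.2.1.2 U ∂(μ s) = g s :=
    fun s hs => by
    rw [integral_zdPlaquetteObs_eq_dim_thooft hd hN (Ioo_subset_Icc_self hs) (hμ s (Ioo_subset_Icc_self hs)) p]
    have h1 := deriv_freeEnergyDensity_eq_plaquette_dim_thooft hd hN hs (hμ s (Ioo_subset_Icc_self hs))
    simp only [hg, ← hf] at h1 ⊢
    rw [h1]
    field_simp
    ring
  obtain ⟨h1, hK0, hdoor⟩ := CouplingResponse.bakryEmery_door_dim (N := N) hd (by omega)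
  have hcont : ContinuousOn (fun b => ∫ U, zdPlaquetteObs (fundamentalRep (Fin N)) p.1 p.2.1.1 p.2.1.2 U ∂(μ b))
      (Icc (0 : ℝ) b₁) :=
    CouplingResponse.continuousOn_integral_dim hd (by omega) hK0
      (Literature.MathematicalPhysics.QuantumFieldTheory.Balaban1983to89.StrongCouplingKernelWindow.oneLinkKRModulus_SU hN h1)
      le_rfl hdoor hμ (isLipschitzCylinder_zdPlaquetteObs (N := N) p.1 p.2.2) (x₀ := p.1) (D := 1)
      (fun e he => by simpa using norm_fst_sub_le_of_mem_plaquetteEdges he)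
  refine monotoneOn_of_deriv_nonneg (convex_Icc _ _) hcont ?_ ?_
  · rw [interior_Icc]
    exact fun s hs => (CouplingResponse.hasDerivAt_plaquette_dim_thooft hd hN hμ p hs).differentiableAt.differentiableWithinAt
  · rw [interior_Icc]
    intro s hs
    have hev : (fun t => ∫ U, zdPlaquetteObs (fundamentalRep (Fin N)) p.1 p.2.1.1 p.2.1.2 U ∂(μ t)) =ᶠ[𝓝 s] g :=
      Filter.eventuallyEq_of_mem (Ioo_mem_nhds hs.1 hs.2) fun t ht => heq t ht
    rw [hev.deriv_eq, ← derivWithin_of_isOpen isOpen_Ioo hs]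
    exact hgmono.derivWithin_nonneg

/-- ★ **Every `SU(N)`, `N ≥ 2`, every `d ≥ 2`: the plaquette–plaquette static susceptibility `Σ_q Cov_ν(W_p, W_q)` is
NON-NEGATIVE** at every `0 < b < N/(12(d-1))`, for every DLR state and every plaquette. -/
theorem plaquette_responseSum_nonneg_dim_thooft (hd : 2 ≤ d) (hN : 2 ≤ N) {b : ℝ}
    (hb : b ∈ Ioo (0 : ℝ) ((N : ℝ) / (12 * ((d : ℝ) - 1))))
    {ν : Measure (LGConfig d (Matrix.specialUnitaryGroup (Fin N) ℂ))}
    (hν : ν ∈ ymGibbsMeasures (d := d) (fundamentalRep (Fin N)) b) (p : ZdPlaquette d) :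
    0 ≤ ∑' q : ZdPlaquette d, cov[zdPlaquetteObs (fundamentalRep (Fin N)) p.1 p.2.1.1 p.2.1.2,
      zdPlaquetteObs (fundamentalRep (Fin N)) q.1 q.2.1.1 q.2.1.2; ν] := by
  classical
  have hN0 : (0 : ℝ) < N := by exact_mod_cast (show 0 < N by omega)
  obtain ⟨μ, hμ⟩ := CouplingResponse.exists_dlrSelection_dim (d := d) (N := N)
  set μ' : ℝ → Measure (LGConfig d (Matrix.specialUnitaryGroup (Fin N) ℂ)) :=
    fun t => if t = b then ν else μ t with hμ'
  have hsel : ∀ t ∈ Icc (0 : ℝ) ((N : ℝ) / (12 * ((d : ℝ) - 1))), μ' t ∈ ymGibbsMeasures (d := d) (fundamentalRep (Fin N)) t := by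
    intro t _
    by_cases ht : t = b
    · simp only [hμ', ht, if_true]; exact hν
    · simp only [hμ', ht, if_false]; exact hμ t
  have hmono := plaquette_monotoneOn_dim_thooft hd hN hsel p
  have hd' := CouplingResponse.hasDerivAt_plaquette_dim_thooft hd hN hsel p hb
  have hμ'b : μ' b = ν := by simp [hμ']
  rw [hμ'b] at hd'
  have h1 : 0 ≤ derivWithin (fun t => ∫ U, zdPlaquetteObs (fundamentalRep (Fin N)) p.1 p.2.1.1 p.2.1.2 U ∂(μ' t))
      (Icc (0 : ℝ) ((N : ℝ) / (12 * ((d : ℝ) - 1)))) b := hmono.derivWithin_nonneg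
  rw [derivWithin_of_mem_nhds (Icc_mem_nhds hb.1 hb.2), hd'.deriv] at h1
  exact nonneg_of_mul_nonneg_right (by simpa [mul_comm] using h1) hN0

end SUNMonotone

end Summit.Ventures.YMGap.PressureRegularity

end
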